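import Summits.AtomisticToContinuum.FouriersLaw.Theses.HoelderEscapeProfile
import Literature.MathematicalPhysics.KineticTheory.InfiniteChainShiftInvariantUniqueness
import Literature.MathematicalPhysics.KineticTheory.InfiniteChainEnergyDensityMoments
import Literature.MathematicalPhysics.KineticTheory.InfiniteChainGoodSetSymmetries
import HarnessLib

/-!
# Stub `stub_pulseBounded` of line `Sketch` (crux `HoelderEscapeProfile.LocalEnergyHalfHoelder`, stmt-AtomisticToContinuum-16008):
# the energy–energy pulse `S(x,t) = Cov_μ(h₀, hₓ∘φ_t)` is uniformly bounded

`--supports stmt-AtomisticToContinuum-16008` (lead `prover-line-stmt-AtomisticToContinuum-16008-0`). For the guarded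
infinite pinned chain `pinnedChain ω₂ lam β γ` (`ω₂, lam, β > 0`), a shift-invariant DLR state `μ` at `T > 0` and a
`μ`-preserving dynamics `D`, the pulse `S x t = ∫ h̃₀ · (h̃ₓ ∘ φ_t) dμ` (`h̃_z = h_z − ∫ h₀ dμ`, `h_z` the split-bond site
energy `OscillatorChain.energyDensityZ`) satisfies `|S x t| ≤ V := ∫ h̃₀² dμ` for all `x, t`.

Proof: `2|fg| ≤ f² + g²` pointwise gives `|∫ f g| ≤ ½(∫ f² + ∫ g²)` (no square roots); `μ` is superstable
(`hasSuperstabilityEstimate_of_isShiftInvariant_pinnedChain`), so `h_z ∈ L²(μ)` (`memLp_energyDensityZ_pinnedChain`);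
`∫ (h̃ₓ∘φ_t)² dμ = ∫ h̃ₓ² dμ` because `φ_t` preserves `μ` (`PreservesMeasure`), and `∫ h̃ₓ² dμ = ∫ h̃₀² dμ` because
`hₓ = h₀ ∘ τ_x` (`energyDensityZ_chainShift`) and `τ_x` preserves the shift-invariant `μ`
(`IsShiftInvariant.measurePreserving_chainShift`). No definitions, no named facts, no sorry.
-/

noncomputable section

open MeasureTheory

namespace Summit.AtomisticToContinuum.FouriersLaw.Theorems.LocalEnergyHalfHoelder.NashDoubling

open Literature.MathematicalPhysics.KineticTheory.HeatConduction

/-- **Square-root-free Cauchy–Schwarz**: `|∫ f g dμ| ≤ ½(∫ f² dμ + ∫ g² dμ)` for `f, g ∈ L²(μ)`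
(from `2|f||g| ≤ f² + g²` pointwise). [folklore] -/
theorem abs_integral_mul_le_half_add_integral_sq {α : Type*} [MeasurableSpace α] {μ : Measure α}
    {f g : α → ℝ} (hf : MemLp f 2 μ) (hg : MemLp g 2 μ) :
    |∫ a, f a * g a ∂μ| ≤ (∫ a, f a ^ 2 ∂μ + ∫ a, g a ^ 2 ∂μ) / 2 := by
  calc |∫ a, f a * g a ∂μ| ≤ ∫ a, |f a * g a| ∂μ := abs_integral_le_integral_abs
    _ ≤ ∫ a, (f a ^ 2 + g a ^ 2) / 2 ∂μ := by
      refine integral_mono_of_nonneg (Filter.Eventually.of_forall fun a => abs_nonneg _)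
        ((hf.integrable_sq.add hg.integrable_sq).div_const 2)
        (Filter.Eventually.of_forall fun a => ?_)
      have h2 := two_mul_le_add_sq (|f a|) (|g a|)
      rw [sq_abs, sq_abs] at h2
      show |f a * g a| ≤ (f a ^ 2 + g a ^ 2) / 2
      rw [abs_mul]
      linarith
    _ = (∫ a, f a ^ 2 ∂μ + ∫ a, g a ^ 2 ∂μ) / 2 := by
      rw [integral_div, integral_add hf.integrable_sq hg.integrable_sq]

/-- Integrals of (measurable) observables along a measure-preserving self-map: `∫ F ∘ φ dμ = ∫ F dμ`. [folklore] -/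
theorem integral_comp_eq_of_measurePreserving {α : Type*} [MeasurableSpace α] {μ : Measure α}
    {φ : α → α} (hφ : MeasurePreserving φ μ μ) {F : α → ℝ} (hF : Measurable F) :
    ∫ a, F (φ a) ∂μ = ∫ a, F a ∂μ := by
  have h := integral_map hφ.measurable.aemeasurable (hF.aestronglyMeasurable (μ := μ.map φ))
  rw [hφ.map_eq] at h
  exact h.symm

/-- **Stub `stub_pulseBounded`** (registered stub of line `Sketch`, crux `LocalEnergyHalfHoelder`, stmt-16008):
the pulse `S x t = ∫ (h₀ − m)(hₓ∘φ_t − m) dμ`, `m = ∫ h₀ dμ`, of the guarded pinned chain is uniformly bounded,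
`|S x t| ≤ V` with `V = ∫ (h₀ − m)² dμ = Var_μ h₀` (square-root-free Cauchy–Schwarz, `φ_t` and `τ_x` preserve `μ`,
`h_z ∈ L²(μ)` by superstability of the shift-invariant DLR state), signature spelled out. [folklore] -/
theorem pulseBounded : ∀ ω₂ lam β γ : ℝ, 0 < ω₂ → 0 < lam → 0 < β → ∀ T : ℝ, 0 < T → ∀ μ : MeasureTheory.Measure Literature.MathematicalPhysics.KineticTheory.HeatConduction.ChainConfig, (Literature.MathematicalPhysics.KineticTheory.HeatConduction.pinnedChain ω₂ lam β γ).IsChainGibbsMeasure T μ → Literature.MathematicalPhysics.KineticTheory.HeatConduction.IsShiftInvariant μ → μ.map (fun σ : Literature.MathematicalPhysics.KineticTheory.HeatConduction.ChainConfig => fun x : ℤ => ((σ x).1, -(σ x).2)) = μ → ∀ D : Literature.MathematicalPhysics.KineticTheory.HeatConduction.InfiniteChainDynamics (Literature.MathematicalPhysics.KineticTheory.HeatConduction.pinnedChain ω₂ lam β γ), D.PreservesMeasure μ → (∀ t : ℝ, ∀ᵐ σ ∂μ, D.flow t (Literature.MathematicalPhysics.KineticTheory.HeatConduction.shift σ)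 = Literature.MathematicalPhysics.KineticTheory.HeatConduction.shift (D.flow t σ)) → ∀ h : Literature.MathematicalPhysics.KineticTheory.HeatConduction.ChainConfig → ℤ → ℝ, h = (fun (σ : Literature.MathematicalPhysics.KineticTheory.HeatConduction.ChainConfig) (x : ℤ) => (σ x).2 ^ 2 / 2 + (Literature.MathematicalPhysics.KineticTheory.HeatConduction.pinnedChain ω₂ lam β γ).U (σ x).1 + ((Literature.MathematicalPhysics.KineticTheory.HeatConduction.pinnedChain ω₂ lam β γ).V ((σ (x + 1)).1 - (σ x).1) + (Literature.MathematicalPhysics.KineticTheory.HeatConduction.pinnedChain ω₂ lam β γ).V ((σ x).1 - (σ (x - 1)).1)) / 2) → ∀ S : ℤ → ℝ → ℝ, S = (fun (x : ℤ) (t : ℝ) => ∫ σ, (h σ 0 - ∫ σ', h σ' 0 ∂μ) * (h (D.flow t σ) x - ∫ σ', h σ' 0 ∂μ) ∂μ) → (∀ ν : ℝ, 0 < ν → MeasureTheory.IntegrableOn (fun t : ℝ => Real.exp (-(ν * t)) * S 0 t) (Set.Ioi 0)) → ∃ V : ℝ, ∀ (x : ℤ) (t : ℝ), |S x t| ≤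 V := by
  intro ω₂ lam β γ hω hl hβ T hT μ hG hSI _hRefl D hP _hShift h hh S hS _hInt
  -- `h` is literally the energy density `energyDensityZ` of the pinned chain
  obtain rfl : h = fun σ x => (pinnedChain ω₂ lam β γ).energyDensityZ σ x := hh
  subst hS
  haveI := hG.isProbabilityMeasure
  -- superstability of the shift-invariant DLR state, hence `h_z ∈ L²(μ)`
  have hss : (pinnedChain ω₂ lam β γ).HasSuperstabilityEstimate μ :=
    OscillatorChain.hasSuperstabilityEstimate_of_isShiftInvariant_pinnedChain γ hω hl.le hβ.le hT hG hSI
  set m : ℝ := ∫ σ', (pinnedChain ω₂ lam β γ).energyDensityZ σ' 0 ∂μ with hm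
  have hmeas : ∀ z : ℤ, Measurable fun σ : ChainConfig => ((pinnedChain ω₂ lam β γ).energyDensityZ σ z - m) ^ 2 :=
    fun z => (((pinnedChain ω₂ lam β γ).measurable_energyDensityZ (OscillatorChain.measurable_pinnedChain_U ω₂ lam β γ)
      (OscillatorChain.measurable_pinnedChain_V ω₂ lam β γ) z).sub_const m).pow_const 2
  have hL2 : ∀ z : ℤ, MemLp (fun σ : ChainConfig => (pinnedChain ω₂ lam β γ).energyDensityZ σ z - m) 2 μ :=
    fun z => (OscillatorChain.memLp_energyDensityZ_pinnedChain γ hω.le hl.le hβ.le hss z (p := 2)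
      ENNReal.ofNat_ne_top).sub (memLp_const m)
  refine ⟨∫ σ, ((pinnedChain ω₂ lam β γ).energyDensityZ σ 0 - m) ^ 2 ∂μ, fun x t => ?_⟩
  show |∫ σ, ((pinnedChain ω₂ lam β γ).energyDensityZ σ 0 - m) *
      ((pinnedChain ω₂ lam β γ).energyDensityZ (D.flow t σ) x - m) ∂μ| ≤ _
  -- `φ_t` preserves `μ`
  have hφ : MeasurePreserving (D.flow t) μ μ := hP.2 t
  have hgt : MemLp (fun σ : ChainConfig => (pinnedChain ω₂ lam β γ).energyDensityZ (D.flow t σ) x - m) 2 μ :=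
    (hL2 x).comp_measurePreserving hφ
  have hI1 : ∫ σ, ((pinnedChain ω₂ lam β γ).energyDensityZ (D.flow t σ) x - m) ^ 2 ∂μ =
      ∫ σ, ((pinnedChain ω₂ lam β γ).energyDensityZ σ x - m) ^ 2 ∂μ :=
    integral_comp_eq_of_measurePreserving hφ (hmeas x)
  -- `τ_x` preserves `μ` and `hₓ = h₀ ∘ τ_x`
  have hI2 : ∫ σ, ((pinnedChain ω₂ lam β γ).energyDensityZ σ x - m) ^ 2 ∂μ =
      ∫ σ, ((pinnedChain ω₂ lam β γ).energyDensityZ σ 0 - m) ^ 2 ∂μ := by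
    rw [← integral_comp_eq_of_measurePreserving (hSI.measurePreserving_chainShift x) (hmeas 0)]
    refine integral_congr_ae (Filter.Eventually.of_forall fun σ => ?_)
    simp only [OscillatorChain.energyDensityZ_chainShift, zero_add]
  calc |∫ σ, ((pinnedChain ω₂ lam β γ).energyDensityZ σ 0 - m) *
          ((pinnedChain ω₂ lam β γ).energyDensityZ (D.flow t σ) x - m) ∂μ|
        ≤ (∫ σ, ((pinnedChain ω₂ lam β γ).energyDensityZ σ 0 - m) ^ 2 ∂μ +
            ∫ σ, ((pinnedChain ω₂ lam β γ).energyDensityZ (D.flow t σ) x - m) ^ 2 ∂μ) / 2 :=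
          abs_integral_mul_le_half_add_integral_sq (hL2 0) hgt
    _ = ∫ σ, ((pinnedChain ω₂ lam β γ).energyDensityZ σ 0 - m) ^ 2 ∂μ := by
          rw [hI1, hI2]; ring

/-- **Statement of the registered stub `stub_pulseBounded`** (verbatim copy of `Stmt.stub_pulseBounded` of the skeleton
`Cruxes/LocalEnergyHalfHoelder/Lines/Sketch.lean`, in this file's namespace so the skeleton can import it without a clash):
the pulse `S(x,t) = Cov_μ(h₀, hₓ∘φ_t)` of the guarded pinned chain is uniformly bounded, `|S x t| ≤ V`. -/
abbrev Stmt.stub_pulseBounded : Prop :=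
    ∀ ω₂ lam β γ : ℝ, 0 < ω₂ → 0 < lam → 0 < β → ∀ T : ℝ, 0 < T → ∀ μ : MeasureTheory.Measure Literature.MathematicalPhysics.KineticTheory.HeatConduction.ChainConfig, (Literature.MathematicalPhysics.KineticTheory.HeatConduction.pinnedChain ω₂ lam β γ).IsChainGibbsMeasure T μ → Literature.MathematicalPhysics.KineticTheory.HeatConduction.IsShiftInvariant μ → μ.map (fun σ : Literature.MathematicalPhysics.KineticTheory.HeatConduction.ChainConfig => fun x : ℤ => ((σ x).1, -(σ x).2)) = μ → ∀ D : Literature.MathematicalPhysics.KineticTheory.HeatConduction.InfiniteChainDynamics (Literature.MathematicalPhysics.KineticTheory.HeatConduction.pinnedChain ω₂ lam β γ), D.PreservesMeasure μ → (∀ t : ℝ, ∀ᵐ σ ∂μ, D.flow t (Literature.MathematicalPhysics.KineticTheory.HeatConduction.shift σ) = Literature.MathematicalPhysics.KineticTheory.HeatConduction.shift (D.flow t σ)) → ∀ h : Literature.MathematicalPhysics.KineticTheory.HeatConduction.ChainConfig → ℤ → ℝ, h = (fun (σ : Literature.MathematicalPhysics.KineticTheory.HeatConduction.ChainConfig) (x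 : ℤ) => (σ x).2 ^ 2 / 2 + (Literature.MathematicalPhysics.KineticTheory.HeatConduction.pinnedChain ω₂ lam β γ).U (σ x).1 + ((Literature.MathematicalPhysics.KineticTheory.HeatConduction.pinnedChain ω₂ lam β γ).V ((σ (x + 1)).1 - (σ x).1) + (Literature.MathematicalPhysics.KineticTheory.HeatConduction.pinnedChain ω₂ lam β γ).V ((σ x).1 - (σ (x - 1)).1)) / 2) → ∀ S : ℤ → ℝ → ℝ, S = (fun (x : ℤ) (t : ℝ) => ∫ σ, (h σ 0 - ∫ σ', h σ' 0 ∂μ) * (h (D.flow t σ) x - ∫ σ', h σ' 0 ∂μ) ∂μ) → (∀ ν : ℝ, 0 < ν → MeasureTheory.IntegrableOn (fun t : ℝ => Real.exp (-(ν * t)) * S 0 t) (Set.Ioi 0)) → ∃ V : ℝ, ∀ (x : ℤ) (t : ℝ), |S x t| ≤ V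

/-- **Registered stub `stub_pulseBounded`** (type `Stmt.stub_pulseBounded`, verbatim the skeleton's): the pulse of the
guarded pinned chain is uniformly bounded, `|S x t| ≤ Var_μ h₀` (`pulseBounded`). [folklore] -/
theorem stub_pulseBounded : Stmt.stub_pulseBounded :=
  pulseBounded

end Summit.AtomisticToContinuum.FouriersLaw.Theorems.LocalEnergyHalfHoelder.NashDoubling

end
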